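import Literature.Computability.AlgebraicComplexity.CircuitGateSemantics
import Summits.ValiantsHypothesis.ValiantsHypothesis.Theorems.DepthWindowHomBlocks
import Mathlib.RingTheory.MvPolynomial.WeightedHomogeneous
import Mathlib.RingTheory.MvPolynomial.Homogeneous
import Mathlib.Data.List.GetD
import HarnessLib

/-!
# Graded substitution of a weighted block into a prefix (stacking bookkeeping for `HomRelStacks`)

Route `DepthWindow`, crux item `HomSubReach`, second-layer statement `HomRelStacks`
(`Theorems/DepthWindowHomRel.lean`): stacking homogenised bands requires substituting, in a block
`Ψ` over weighted variables `τ`, each variable `t` by an operand `θ t` pointing into an already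
built prefix `Acc` over `σ` (whose value is homogeneous of degree `w t`), shifting the block's own
gate references by `|Acc|`.  This file provides that operation (`Operand.substShift`,
`Gate.substShift`) and its three bookkeeping facts: VALUES of the appended block are the images of
the block's values under the algebra map `aeval Θ`, `Θ t = (θ t).eval (gateValues Acc)`
(`gateValues_append_substShift`); DEPTH entries grow by at most the depth of the substituted
operands (`getD_gateWDepths_append_substShift_le`); and graded substitution maps weighted
homogeneous values to homogeneous values and weighted components to homogeneous components
(`IsWeightedHomogeneous.aeval_graded`, `aeval_graded_weightedHomogeneousComponent`).

[cite: LimayeSrinivasanTavenas2025, Lemma 19, Lemma 20] [cite: Burgisser2000, Def. 2.1, proof of Prop. 2.3]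
[cite: LST2021, §2]
-/

set_option linter.dupNamespace false

namespace Summit.ValiantsHypothesis.ValiantsHypothesis.Theorems.DepthWindow

open MvPolynomial Literature.Computability.AlgebraicComplexity ArithCircuit
open Literature.Computability.AlgebraicComplexity.DepthReduction

variable {k : Type*} [CommSemiring k] {σ τ : Type*}

/-! ### The substitution-and-shift operation -/

/-- Substitute the variables of an operand over `τ` by operands over `σ` and shift its gate
references by `L` (the length of the prefix the result is appended to).
[cite: Burgisser2000, Def. 2.1, proof of Prop. 2.3] -/
def Operand.substShift (θ : τ → Operand k σ) (L : ℕ) : Operand k τ → Operand k σ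
  | .var t => θ t
  | .const c => .const c
  | .gate j => .gate (L + j)

/-- `Operand.substShift` applied to every operand of a gate (kind and coefficients kept).
[cite: Burgisser2000, Def. 2.1, proof of Prop. 2.3] -/
def Gate.substShift (θ : τ → Operand k σ) (L : ℕ) : Gate k τ → Gate k σ
  | .sum args => .sum (args.map fun a => (a.1, Operand.substShift θ L a.2))
  | .prod us => .prod (us.map (Operand.substShift θ L))

omit [CommSemiring k] in
/-- Substitution keeps the product weight of a gate. [cite: LimayeSrinivasanTavenas2025, §1] -/
@[simp] theorem prodWeight_substShift (θ : τ → Operand k σ) (L : ℕ) :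
    ∀ G : Gate k τ, prodWeight (Gate.substShift θ L G) = prodWeight G
  | .sum _ => rfl
  | .prod _ => rfl

omit [CommSemiring k] in
/-- The operands of a substituted gate. -/
theorem args_substShift (θ : τ → Operand k σ) (L : ℕ) :
    ∀ G : Gate k τ, (Gate.substShift θ L G).args = G.args.map (Operand.substShift θ L)
  | .sum args => by simp only [Gate.substShift, Gate.args, List.map_map, Function.comp_def]
  | .prod us => by simp only [Gate.substShift, Gate.args]

omit [CommSemiring k] in
/-- Length of a substituted block. -/
@[simp] theorem length_map_substShift (θ : τ → Operand k σ) (L : ℕ) (Ψ : List (Gate k τ)) :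
    (Ψ.map (Gate.substShift θ L)).length = Ψ.length := List.length_map _

/-! ### Values -/

section Values

variable (θ : τ → Operand k σ) (VA : List (MvPolynomial σ k))

/-- The algebra map of the substitution: `t ↦` the value of `θ t` against the prefix values. -/
noncomputable def substMap : MvPolynomial τ k →ₐ[k] MvPolynomial σ k :=
  aeval fun t => (θ t).eval VA

/-- Value of a substituted operand against `prefix values ++ images of the block values`.
[cite: Burgisser2000, Def. 2.1, proof of Prop. 2.3] -/
theorem eval_substShift (hθ : ∀ t, (θ t).RefsBelow VA.length) (Vτ : List (MvPolynomial τ k)) :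
    ∀ u : Operand k τ, (Operand.substShift θ VA.length u).eval (VA ++ Vτ.map (substMap θ VA)) =
      substMap θ VA (u.eval Vτ)
  | .var t => by
      simp only [Operand.substShift, Operand.eval, substMap, aeval_X]
      exact operand_eval_append_of_refsBelow VA _ (hθ t)
  | .const c => by simp only [Operand.substShift, Operand.eval, substMap, algHom_C, algebraMap_eq]
  | .gate j => by
      simp only [Operand.substShift, Operand.eval]
      rw [List.getD_append_right _ _ _ _ (Nat.le_add_right _ _), Nat.add_sub_cancel_left,
        ← map_zero (substMap θ VA), List.getD_map]

/-- Value of a substituted gate. [cite: Burgisser2000, Def. 2.1, proof of Prop. 2.3] -/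
theorem gate_eval_substShift (hθ : ∀ t, (θ t).RefsBelow VA.length) (Vτ : List (MvPolynomial τ k)) :
    ∀ G : Gate k τ, (Gate.substShift θ VA.length G).eval (VA ++ Vτ.map (substMap θ VA)) =
      substMap θ VA (G.eval Vτ)
  | .sum args => by
      simp only [Gate.substShift, Gate.eval, map_list_sum, List.map_map]
      congr 1
      refine List.map_congr_left fun a _ => ?_
      simp only [Function.comp_apply, map_smul, eval_substShift θ VA hθ Vτ]
  | .prod us => by
      simp only [Gate.substShift, Gate.eval, map_list_prod, List.map_map]
      congr 1
      refine List.map_congr_left fun u _ => ?_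
      simp only [Function.comp_apply, eval_substShift θ VA hθ Vτ]

/-- **Values of an appended substituted block**: the prefix values followed by the images of the
block's own values under the substitution map. [cite: Burgisser2000, Def. 2.1, proof of Prop. 2.3]
[cite: LimayeSrinivasanTavenas2025, Lemma 20] -/
theorem gateValues_append_substShift (Acc : List (Gate k σ)) (hθ : ∀ t, (θ t).RefsBelow Acc.length) :
    ∀ Ψ : List (Gate k τ), gateValues (Acc ++ Ψ.map (Gate.substShift θ Acc.length)) =
      gateValues Acc ++ (gateValues Ψ).map (substMap θ (gateValues Acc)) := by
  intro Ψ
  induction Ψ using List.reverseRecOn with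
  | nil => simp [gateValues]
  | append_singleton B G ih =>
      have hL : (gateValues Acc).length = Acc.length := gateValues_length Acc
      rw [List.map_append, List.map_singleton, ← List.append_assoc, gateValues_append_singleton,
        ih, gateValues_append_singleton, List.map_append, List.map_singleton, List.append_assoc]
      congr 2
      rw [← hL]
      exact congrArg (fun x => [x]) (gate_eval_substShift θ (gateValues Acc) (hL.symm ▸ hθ) (gateValues B) G)

end Values

/-! ### Depths -/

section Depths

variable (θ : τ → Operand k σ)

omit [CommSemiring k] in
/-- `foldr max 0` comparison with an additive slack. -/
theorem foldr_max_map_le_add {α : Type*} (l : List α) (f g : α → ℕ) (M : ℕ)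
    (h : ∀ x ∈ l, f x ≤ g x + M) : (l.map f).foldr max 0 ≤ (l.map g).foldr max 0 + M := by
  induction l with
  | nil => exact Nat.zero_le _
  | cons a l ih =>
      simp only [List.map_cons, List.foldr_cons]
      refine max_le ((h a (by simp)).trans (Nat.add_le_add_right (le_max_left _ _) M)) ?_
      exact (ih fun x hx => h x (by simp [hx])).trans (Nat.add_le_add_right (le_max_right _ _) M)

omit [CommSemiring k] in
/-- Depth of a substituted operand against `prefix depths ++ new depths`, when the substituted
operands have depth `≤ M` against the prefix and the new depths dominate the old ones up to `M`.
[cite: LST2021, §2] -/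
theorem depthIn_substShift_le (DA Dτ Dnew : List ℕ) (M : ℕ) (hθ : ∀ t, (θ t).RefsBelow DA.length)
    (hM : ∀ t, (θ t).depthIn DA ≤ M) (hlen : Dnew.length = Dτ.length)
    (hnew : ∀ i < Dτ.length, Dnew.getD i 0 ≤ Dτ.getD i 0 + M) :
    ∀ u : Operand k τ, (Operand.substShift θ DA.length u).depthIn (DA ++ Dnew) ≤ u.depthIn Dτ + M
  | .var t => by
      show (θ t).depthIn (DA ++ Dnew) ≤ Operand.depthIn Dτ (.var t : Operand k τ) + M
      rw [depthIn_append_of_refsBelow DA Dnew (hθ t)]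
      exact (hM t).trans (by simp [Operand.depthIn])
  | .const c => by simp only [Operand.substShift, Operand.depthIn]; exact Nat.zero_le _
  | .gate j => by
      simp only [Operand.substShift, Operand.depthIn]
      rw [List.getD_append_right _ _ _ _ (Nat.le_add_right _ _), Nat.add_sub_cancel_left]
      by_cases hj : j < Dτ.length
      · exact hnew j hj
      · rw [List.getD_eq_default _ _ (by rw [hlen]; omega),
          List.getD_eq_default _ _ (by omega)]
        exact Nat.zero_le _

omit [CommSemiring k] in
/-- **Depths of an appended substituted block**: entry `|Acc| + i` of the new depth list is at
most entry `i` of the block's own depth list plus the maximal depth `M` of the substituted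
operands. [cite: LST2021, §2] [cite: LimayeSrinivasanTavenas2025, Lemma 20] -/
theorem getD_gateWDepths_append_substShift_le (Acc : List (Gate k σ)) (M : ℕ)
    (hθ : ∀ t, (θ t).RefsBelow Acc.length)
    (hM : ∀ t, (θ t).depthIn (gateWDepths prodWeight Acc) ≤ M) :
    ∀ (Ψ : List (Gate k τ)) (i : ℕ), i < Ψ.length →
      (gateWDepths prodWeight (Acc ++ Ψ.map (Gate.substShift θ Acc.length))).getD
          (Acc.length + i) 0 ≤ (gateWDepths prodWeight Ψ).getD i 0 + M := by
  intro Ψ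
  induction Ψ using List.reverseRecOn with
  | nil => intro i hi; exact absurd hi (Nat.not_lt_zero i)
  | append_singleton B G ih =>
      intro i hi
      have hDA : (gateWDepths prodWeight Acc).length = Acc.length := gateWDepths_length _ _
      have hDB : (gateWDepths prodWeight B).length = B.length := gateWDepths_length _ _
      -- the combined depth list, split as prefix ++ new part
      obtain ⟨Dnew, hDnew, hDlen⟩ := gateWDepths_prefix prodWeight Acc (B.map (Gate.substShift θ Acc.length))
      rw [List.length_map] at hDlen
      have hnewB : ∀ i' < B.length, Dnew.getD i' 0 ≤ (gateWDepths prodWeight B).getD i' 0 + M := by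
        intro i' hi'
        have := ih i' hi'
        rwa [hDnew, ← hDA, List.getD_append_right _ _ _ _ (Nat.le_add_right _ _),
          Nat.add_sub_cancel_left] at this
      rw [List.length_append, List.length_singleton] at hi
      rw [List.map_append, List.map_singleton, ← List.append_assoc, gateWDepths_append_singleton,
        gateWDepths_append_singleton, hDnew]
      by_cases hi' : i < B.length
      · rw [List.append_assoc, ← hDA, List.getD_append_right _ _ _ _ (Nat.le_add_right _ _),
          Nat.add_sub_cancel_left, List.getD_append _ _ _ _ (by rw [hDlen]; exact hi'),
          List.getD_append _ _ _ _ (by rw [hDB]; exact hi')]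
        exact hnewB i hi'
      · have hiB : i = B.length := by omega
        subst hiB
        rw [List.append_assoc, ← hDA, List.getD_append_right _ _ _ _ (Nat.le_add_right _ _),
          Nat.add_sub_cancel_left, hDA,
          List.getD_append_right _ _ _ _ (by rw [hDlen]), hDlen, Nat.sub_self, List.getD_cons_zero,
          List.getD_append_right _ _ _ _ (by rw [hDB]), hDB, Nat.sub_self, List.getD_cons_zero,
          prodWeight_substShift, args_substShift, List.map_map, Nat.add_assoc]
        refine Nat.add_le_add_left ?_ _
        have key := foldr_max_map_le_add G.args
          (Operand.depthIn (gateWDepths prodWeight Acc ++ Dnew) ∘ Operand.substShift θ Acc.length)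
          (Operand.depthIn (gateWDepths prodWeight B)) M (fun u _ => by
            simp only [Function.comp_apply]
            rw [← hDA]
            exact depthIn_substShift_le θ _ _ _ M (hDA.symm ▸ hθ) hM (hDlen.trans hDB.symm)
              (fun i' hi'' => hnewB i' (hDB ▸ hi'')) u)
        simpa [List.map_map] using key

end Depths

/-! ### Graded substitution and homogeneity -/

section Graded

variable (w : τ → ℕ) (Θ : τ → MvPolynomial σ k)

/-- The image of a monomial under a graded substitution (`Θ t` homogeneous of degree `w t`) is
homogeneous of degree the weight of the monomial. -/
theorem isHomogeneous_aeval_monomial (hΘ : ∀ t, (Θ t).IsHomogeneous (w t)) (m : τ →₀ ℕ) (c : k) :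
    (aeval Θ (monomial m c)).IsHomogeneous (Finsupp.weight w m) := by
  have hprod : (m.prod fun t e => Θ t ^ e).IsHomogeneous (∑ t ∈ m.support, m t * w t) := by
    rw [Finsupp.prod]
    refine IsHomogeneous.prod _ _ (fun t => m t * w t) fun t _ => ?_
    have h := (hΘ t).pow (m t)
    rw [Nat.mul_comm]
    exact h
  have hw : Finsupp.weight w m = ∑ t ∈ m.support, m t * w t := by
    rw [Finsupp.weight_apply, Finsupp.sum]
    simp only [smul_eq_mul]
  rw [aeval_monomial, hw, ← zero_add (∑ t ∈ m.support, m t * w t)]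
  exact (isHomogeneous_C σ c).mul hprod

/-- **Graded substitution preserves homogeneity**: a weighted homogeneous polynomial of weight
`n` is mapped to a homogeneous polynomial of degree `n`. [cite: LimayeSrinivasanTavenas2025, Lemma 20] -/
theorem IsWeightedHomogeneous.aeval_graded (hΘ : ∀ t, (Θ t).IsHomogeneous (w t))
    {p : MvPolynomial τ k} {n : ℕ} (hp : p.IsWeightedHomogeneous w n) :
    (aeval Θ p).IsHomogeneous n := by
  rw [p.as_sum, map_sum]
  refine IsHomogeneous.sum _ _ n fun m hm => ?_
  have hwm : Finsupp.weight w m = n := hp (Finsupp.mem_support_iff.mp hm)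
  rw [← hwm]
  exact isHomogeneous_aeval_monomial w Θ hΘ m _

/-- **Graded substitution commutes with taking components**: the image of the weight-`e`
component is the degree-`e` homogeneous component of the image.
[cite: LimayeSrinivasanTavenas2025, Lemma 20] -/
theorem aeval_graded_weightedHomogeneousComponent (hΘ : ∀ t, (Θ t).IsHomogeneous (w t))
    (e : ℕ) (p : MvPolynomial τ k) :
    aeval Θ (weightedHomogeneousComponent w e p) = homogeneousComponent e (aeval Θ p) := by
  classical
  conv_rhs => rw [p.as_sum, map_sum, map_sum]
  conv_lhs => rw [p.as_sum, map_sum, map_sum]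
  refine Finset.sum_congr rfl fun m _ => ?_
  have hmono : IsWeightedHomogeneous w (monomial m (coeff m p)) (Finsupp.weight w m) :=
    isWeightedHomogeneous_monomial w m _ rfl
  have himg : (aeval Θ (monomial m (coeff m p))).IsHomogeneous (Finsupp.weight w m) :=
    isHomogeneous_aeval_monomial w Θ hΘ m _
  by_cases he : e = Finsupp.weight w m
  · subst he
    rw [hmono.weightedHomogeneousComponent_same]
    exact (himg.weightedHomogeneousComponent_same).symm
  · rw [hmono.weightedHomogeneousComponent_ne e he, map_zero]
    exact (himg.weightedHomogeneousComponent_ne e he).symm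

end Graded

end Summit.ValiantsHypothesis.ValiantsHypothesis.Theorems.DepthWindow
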